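import Literature.MathematicalPhysics.QuantumFieldTheory.Balaban1983to89.T4VitaliStep
import Literature.MathematicalPhysics.QuantumFieldTheory.Balaban1983to89.T4GenFunBounds
import Mathlib.MeasureTheory.Integral.RieszMarkovKakutani.Real
import Mathlib.Topology.ContinuousMap.Weierstrass
import Mathlib.MeasureTheory.Measure.ProbabilityMeasure

/-!
# BalabanUVNodes ∕ N19 (NE7 proper) — THE CONTINUUM LAW OF A BOUNDED OBSERVABLE, GENERIC HALF [folklore]: uniformly bounded observables on a
# sequence of probability spaces ALL OF WHOSE MOMENTS CONVERGE (node E3's output) have a UNIQUE limit LAW `ν` on `[−B, B]`; the laws converge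
# WEAKLY to `ν`, the MGFs ∕ cgf's ∕ complex MGFs ∕ characteristic functions converge to `ν`'s transforms, and the source-tilted laws converge to
# the exponential tilts of `ν`

Cell `pub-ymgap` (HUMAN RULING D-0062, Track A), R141 (C) WIDER STRATEGY seat `pub-ymgap-dag-n19-e` (strategy s3 «alternative currency»), gen 9, first
module (generic half; the at-scheme half under N19's DECL target `Spine.NE7.Target` is the sibling `…N19ContinuumLawAtScheme`); filed
`--kind proof --supports` K3⁗ `SpineGivenEndpointR13Sep` = stmt-QuantumFields-20292 `--as helper` (route rev 19; plan KEY-18, dag-lead WORDS-140,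
director-ym №140).  COUNT-NEUTRAL.  THEOREMS ONLY (0 `def`); imports the tree's node E3 `T4VitaliStep` (`tendsto_moment_of_tendsto_cgf`), `T4GenFunBounds`
(`exp_neg_le_mgf_of_abs_le`) and three Mathlib files (Riesz–Markov–Kakutani for `ℝ`-linear functionals, Weierstrass approximation, weak convergence of
probability measures); edits nothing.

WHAT THIS IS.  The last rung of this seat's expectation-currency ladder (g4 expectations `…N19ExpectationCurrency` → g5 the lin-log rate
`…TwoConstantsRate` → g8 sourced expectations ∕ every source ∕ real-analytic `genFunLim`): the LAW itself, generic half — Hausdorff determinacy on a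
compact interval, typed once for any sequence of probability spaces `(Ω_K, μ_K)` and observables `|X_K| ≤ B` ALL OF WHOSE MOMENTS CONVERGE: then
`∫ f(X_K) dμ_K` converges for EVERY continuous `f` (Weierstrass on `[−B, B]` + Cauchy, ★ `tendsto_integral_comp_of_tendsto_moments`; `…_of_continuousOn`),
the limits are the integrals against ONE probability measure `ν` on `ℝ` carried by `[−B, B]` (Riesz–Markov–Kakutani on the compact interval for the
limit functional, pushed forward to `ℝ`; ★★ `exists_lawLimit_of_tendsto_moments`), i.e. the laws `(μ K).map (X K)` converge WEAKLY to `ν` in Mathlib's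
`ProbabilityMeasure ℝ` (`tendsto_law_of_lawLimit`); `ν` is UNIQUE (`lawLimit_unique`); its transforms are the limits of the MGFs ∕ cgf's ∕ complex MGFs ∕
characteristic functions (`tendsto_mgf_of_lawLimit`, `tendsto_cgf_of_lawLimit`, `tendsto_complexMGF_of_lawLimit`, `tendsto_charFun_of_lawLimit`); and
for every source `s` the `s·X_K`-tilted laws converge to the `s`-tilt of `ν` (`tendsto_integral_comp_tilted_of_lawLimit`).  In node E3's wording the
moment hypothesis reads «the cgf's converge on `(0, r)`» (`exists_lawLimit_of_tendsto_cgf`, by the tree's `T4VitaliStep.tendsto_moment_of_tendsto_cgf`).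

HONEST FRAMING.  [folklore] (Hausdorff ∕ Weierstrass ∕ Riesz–Markov–Kakutani ∕ Vitali) BY NAME over Mathlib; no estimate, no rate; hypothesis SHAPES only —
nothing of Bałaban's is instantiated, NE7 NOT PRINTED ∕ NOT proved, N19 NOT discharged (0∕1), K3⁗ NOT claimed, counts UNMOVED (5∕27).  One finite
four-torus programme at fixed `ε` when applied (sibling) — NOT ℝ⁴, NOT infinite volume, NOT OS, NOT a mass gap, NOT Clay.  0 `def`; 0 `sorry`; standard
axioms; no decl below carries a cite tag.
-/

noncomputable section

open Set Filter Topology MeasureTheory ProbabilityTheory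
open scoped CompactlySupported

namespace Summit.QuantumFields.YangMills.BalabanUVNodes.N19ContinuumLaw

open Literature.MathematicalPhysics.QuantumFieldTheory.Balaban1983to89

/-! ## Generic [folklore]: uniformly bounded observables all of whose moments converge have a unique continuum LAW on `[−B, B]`;
the laws converge weakly to it, its transforms are the limits of the transforms, and the source-tilted laws converge to its tilts -/

section OneSpace

variable {Ω₁ : Type*} [MeasurableSpace Ω₁] {μ₁ : Measure Ω₁} [IsFiniteMeasure μ₁] {Y : Ω₁ → ℝ} {B : ℝ}

/-- A continuous function of an a.e.-bounded real observable on a finite measure space is integrable (bounded on `[−B, B]`). [folklore] -/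
theorem integrable_comp_of_continuous {E : Type*} [NormedAddCommGroup E] (hY : AEMeasurable Y μ₁) (hB : ∀ᵐ ω ∂μ₁, |Y ω| ≤ B)
    {f : ℝ → E} (hf : Continuous f) : Integrable (fun ω => f (Y ω)) μ₁ := by
  obtain ⟨C, hC⟩ := (isCompact_Icc : IsCompact (Icc (-B) B)).exists_bound_of_continuousOn hf.continuousOn
  exact (integrable_const C).mono' (hf.comp_aestronglyMeasurable hY.aestronglyMeasurable)
    (hB.mono fun ω hω => hC _ (abs_le.1 hω))

/-- The source-tilted integral of `f(Y)` is the normalised `e^{sY}`-weighted integral (Mathlib `integral_tilted`). [folklore] -/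
theorem integral_comp_tilted_eq (m : Measure Ω₁) (Y : Ω₁ → ℝ) (f : ℝ → ℝ) (s : ℝ) :
    ∫ x, f (Y x) ∂m.tilted (fun x => s * Y x) = (∫ x, Real.exp (s * Y x) ∂m)⁻¹ * ∫ x, Real.exp (s * Y x) * f (Y x) ∂m := by
  rw [integral_tilted]
  simp_rw [smul_eq_mul, div_eq_inv_mul, mul_assoc]
  exact integral_const_mul _ _

/-- The real part of the complex MGF is the integral of the real part of `e^{zY}` (Mathlib `integral_re`). [folklore] -/
theorem re_complexMGF_eq_integral (m : Measure Ω₁) (Y : Ω₁ → ℝ) (z : ℂ) (hI : Integrable (fun x => Complex.exp (z * Y x)) m) :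
    (complexMGF Y m z).re = ∫ x, (Complex.exp (z * Y x)).re ∂m := by
  have h := integral_re hI
  simpa [complexMGF] using h.symm

/-- The imaginary part of the complex MGF is the integral of the imaginary part of `e^{zY}` (Mathlib `integral_im`). [folklore] -/
theorem im_complexMGF_eq_integral (m : Measure Ω₁) (Y : Ω₁ → ℝ) (z : ℂ) (hI : Integrable (fun x => Complex.exp (z * Y x)) m) :
    (complexMGF Y m z).im = ∫ x, (Complex.exp (z * Y x)).im ∂m := by
  have h := integral_im hI
  simpa [complexMGF] using h.symm

end OneSpace

section Generic

variable {Ω : ℕ → Type*} [∀ K, MeasurableSpace (Ω K)] {μ : ∀ K, Measure (Ω K)} [∀ K, IsProbabilityMeasure (μ K)]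
  {X : ∀ K, Ω K → ℝ} {B : ℝ}

include μ in
/-- A uniform bound `|X K ω| ≤ B` of observables on probability spaces forces `0 ≤ B` (probability spaces are non-empty). [folklore] -/
theorem nonneg_of_absBound (hB : ∀ K ω, |X K ω| ≤ B) : 0 ≤ B := by
  rcases isEmpty_or_nonempty (Ω 0) with h | ⟨⟨ω⟩⟩
  · have h1 := measure_univ (μ := μ 0)
    rw [Set.univ_eq_empty_iff.mpr h, measure_empty] at h1
    exact absurd h1 zero_ne_one
  · exact (abs_nonneg _).trans (hB 0 ω)

/-- **POLYNOMIAL OBSERVABLES CONVERGE**: if every moment `∫ (X K)ⁿ dμ_K` converges, so does `∫ p(X K) dμ_K` for every real polynomial `p`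
(linearity of the integral). [folklore] -/
theorem tendsto_integral_polynomial_of_tendsto_moments (hX : ∀ K, AEMeasurable (X K) (μ K)) (hB : ∀ K ω, |X K ω| ≤ B)
    (hmom : ∀ n : ℕ, ∃ a : ℝ, Tendsto (fun K => ∫ ω, X K ω ^ n ∂μ K) atTop (𝓝 a)) (p : Polynomial ℝ) :
    ∃ a : ℝ, Tendsto (fun K => ∫ ω, p.eval (X K ω) ∂μ K) atTop (𝓝 a) := by
  induction p using Polynomial.induction_on' with
  | add p q hp hq =>
    obtain ⟨a, ha⟩ := hp
    obtain ⟨b, hb⟩ := hq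
    refine ⟨a + b, (ha.add hb).congr fun K => ?_⟩
    simp only [Polynomial.eval_add]
    exact (integral_add (integrable_comp_of_continuous (hX K) (ae_of_all _ (hB K)) p.continuous)
      (integrable_comp_of_continuous (hX K) (ae_of_all _ (hB K)) q.continuous)).symm
  | monomial n c =>
    obtain ⟨a, ha⟩ := hmom n
    refine ⟨c * a, (ha.const_mul c).congr fun K => ?_⟩
    simp only [Polynomial.eval_monomial]
    exact (integral_const_mul c _).symm

/-- ★ **EVERY CONTINUOUS OBSERVABLE OF `X_K` CONVERGES** [folklore]: probability spaces `μ K`, observables `|X K| ≤ B` (a.e.-measurable) all of whose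
moments converge; then `∫ f(X K) dμ_K` converges for EVERY continuous `f : ℝ → ℝ` — Weierstrass on `[−B, B]` (Mathlib
`exists_polynomial_near_of_continuousOn`) and the Cauchy criterion. -/
theorem tendsto_integral_comp_of_tendsto_moments (hX : ∀ K, AEMeasurable (X K) (μ K)) (hB : ∀ K ω, |X K ω| ≤ B)
    (hmom : ∀ n : ℕ, ∃ a : ℝ, Tendsto (fun K => ∫ ω, X K ω ^ n ∂μ K) atTop (𝓝 a)) {f : ℝ → ℝ} (hf : Continuous f) :
    ∃ a : ℝ, Tendsto (fun K => ∫ ω, f (X K ω) ∂μ K) atTop (𝓝 a) := by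
  refine cauchySeq_tendsto_of_complete (Metric.cauchySeq_iff'.2 fun ε hε => ?_)
  obtain ⟨p, hp⟩ := exists_polynomial_near_of_continuousOn (-B) B f hf.continuousOn (ε / 3) (by positivity)
  obtain ⟨a, ha⟩ := tendsto_integral_polynomial_of_tendsto_moments hX hB hmom p
  obtain ⟨N, hN⟩ := Metric.cauchySeq_iff'.1 ha.cauchySeq (ε / 3) (by positivity)
  have hclose : ∀ K, dist (∫ ω, f (X K ω) ∂μ K) (∫ ω, p.eval (X K ω) ∂μ K) ≤ ε / 3 := fun K => by
    rw [dist_eq_norm, ← integral_sub (integrable_comp_of_continuous (hX K) (ae_of_all _ (hB K)) hf)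
      (integrable_comp_of_continuous (hX K) (ae_of_all _ (hB K)) p.continuous)]
    refine (norm_integral_le_of_norm_le_const (C := ε / 3) (Eventually.of_forall fun ω => ?_)).trans
      (by rw [probReal_univ, mul_one])
    rw [Real.norm_eq_abs, abs_sub_comm]
    exact (hp _ (abs_le.1 (hB K ω))).le
  refine ⟨N, fun K hK => ?_⟩
  calc dist (∫ ω, f (X K ω) ∂μ K) (∫ ω, f (X N ω) ∂μ N)
      ≤ dist (∫ ω, f (X K ω) ∂μ K) (∫ ω, p.eval (X K ω) ∂μ K)
          + dist (∫ ω, p.eval (X K ω) ∂μ K) (∫ ω, p.eval (X N ω) ∂μ N)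
          + dist (∫ ω, p.eval (X N ω) ∂μ N) (∫ ω, f (X N ω) ∂μ N) := dist_triangle4 _ _ _ _
    _ < ε / 3 + ε / 3 + ε / 3 := by
        have h₁ := hclose K
        have h₂ := hN K hK
        have h₃ := hclose N
        rw [dist_comm] at h₃
        linarith
    _ = ε := by ring

/-- The same for `f` merely continuous ON `[−B, B]` (extend by the continuous retraction `projIcc`; the values of `X K` lie in `[−B, B]`). [folklore] -/
theorem tendsto_integral_comp_of_tendsto_moments_of_continuousOn (hX : ∀ K, AEMeasurable (X K) (μ K)) (hB : ∀ K ω, |X K ω| ≤ B)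
    (hmom : ∀ n : ℕ, ∃ a : ℝ, Tendsto (fun K => ∫ ω, X K ω ^ n ∂μ K) atTop (𝓝 a)) {f : ℝ → ℝ} (hf : ContinuousOn f (Icc (-B) B)) :
    ∃ a : ℝ, Tendsto (fun K => ∫ ω, f (X K ω) ∂μ K) atTop (𝓝 a) := by
  have h0 : -B ≤ B := by have := nonneg_of_absBound (μ := μ) hB; linarith
  have hc : Continuous fun x => f (projIcc (-B) B h0 x) :=
    hf.comp_continuous (continuous_subtype_val.comp continuous_projIcc) fun x => (projIcc (-B) B h0 x).2
  obtain ⟨a, ha⟩ := tendsto_integral_comp_of_tendsto_moments hX hB hmom (f := fun x => f (projIcc (-B) B h0 x)) hc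
  refine ⟨a, ha.congr fun K => integral_congr_ae (Eventually.of_forall fun ω => ?_)⟩
  simp only [projIcc_of_mem h0 (show X K ω ∈ Icc (-B) B from abs_le.1 (hB K ω))]

/-- ★★ **THE CONTINUUM LAW** [folklore] (Hausdorff determinacy on a compact interval, via Riesz–Markov–Kakutani): probability spaces `μ K`,
observables `|X K| ≤ B` (a.e.-measurable) ALL OF WHOSE MOMENTS CONVERGE; then there is a probability measure `ν` on `ℝ`, carried by `[−B, B]`,
with `∫ f(X K) dμ_K → ∫ f dν` for EVERY continuous `f : ℝ → ℝ`.  Construction: the limit functional `φ ↦ lim_K ∫ φ(X K) dμ_K` on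
`C([−B, B], ℝ)` (previous theorem) is linear, positive and normalised; Mathlib `RealRMK.rieszMeasure` on the compact interval, pushed forward to `ℝ`. -/
theorem exists_lawLimit_of_tendsto_moments (hX : ∀ K, AEMeasurable (X K) (μ K)) (hB : ∀ K ω, |X K ω| ≤ B)
    (hmom : ∀ n : ℕ, ∃ a : ℝ, Tendsto (fun K => ∫ ω, X K ω ^ n ∂μ K) atTop (𝓝 a)) :
    ∃ ν : Measure ℝ, IsProbabilityMeasure ν ∧ ν (Icc (-B) B)ᶜ = 0 ∧
      ∀ f : ℝ → ℝ, Continuous f → Tendsto (fun K => ∫ ω, f (X K ω) ∂μ K) atTop (𝓝 (∫ x, f x ∂ν)) := by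
  have h0 : -B ≤ B := by have := nonneg_of_absBound (μ := μ) hB; linarith
  have hmem : ∀ K ω, X K ω ∈ Icc (-B) B := fun K ω => abs_le.1 (hB K ω)
  -- the limit functional on `C([−B, B], ℝ)`
  have hL : ∀ φ : C(Icc (-B) B, ℝ), ∃ a : ℝ, Tendsto (fun K => ∫ ω, φ (projIcc (-B) B h0 (X K ω)) ∂μ K) atTop (𝓝 a) :=
    fun φ => tendsto_integral_comp_of_tendsto_moments hX hB hmom (f := fun x => φ (projIcc (-B) B h0 x))
      (φ.continuous.comp continuous_projIcc)
  choose L hL using hL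
  have hI : ∀ (K) (φ : C(Icc (-B) B, ℝ)), Integrable (fun ω => φ (projIcc (-B) B h0 (X K ω))) (μ K) := fun K φ =>
    integrable_comp_of_continuous (hX K) (ae_of_all _ (hB K)) (f := fun x => φ (projIcc (-B) B h0 x))
      (φ.continuous.comp continuous_projIcc)
  have hadd : ∀ φ ψ : C(Icc (-B) B, ℝ), L (φ + ψ) = L φ + L ψ := fun φ ψ =>
    tendsto_nhds_unique (hL (φ + ψ)) (((hL φ).add (hL ψ)).congr fun K => by
      simp only [ContinuousMap.add_apply]
      exact (integral_add (hI K φ) (hI K ψ)).symm)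
  have hsmul : ∀ (c : ℝ) (φ : C(Icc (-B) B, ℝ)), L (c • φ) = c * L φ := fun c φ =>
    tendsto_nhds_unique (hL (c • φ)) (((hL φ).const_mul c).congr fun K => by
      simp only [ContinuousMap.smul_apply, smul_eq_mul]
      exact (integral_const_mul c _).symm)
  have hpos : ∀ φ : C(Icc (-B) B, ℝ), (∀ y, 0 ≤ φ y) → 0 ≤ L φ := fun φ hφ =>
    ge_of_tendsto' (hL φ) fun K => integral_nonneg fun ω => hφ _
  have hone : L 1 = 1 := tendsto_nhds_unique (hL 1) (tendsto_const_nhds.congr fun K => by simp)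
  -- Riesz–Markov–Kakutani on the compact interval
  let Λₗ : C_c(Icc (-B) B, ℝ) →ₗ[ℝ] ℝ :=
    { toFun := fun f => L f.toContinuousMap
      map_add' := fun f g => by
        have : (f + g).toContinuousMap = f.toContinuousMap + g.toContinuousMap := by ext; rfl
        rw [this, hadd]
      map_smul' := fun c f => by
        have : (c • f).toContinuousMap = c • f.toContinuousMap := by ext; rfl
        rw [this, hsmul]
        rfl }
  let Λp : C_c(Icc (-B) B, ℝ) →ₚ[ℝ] ℝ := PositiveLinearMap.mk₀ Λₗ fun f hf => hpos f.toContinuousMap fun y => hf y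
  have hΛp : ∀ f, Λp f = L f.toContinuousMap := fun _ => rfl
  let ν₀ : Measure (Icc (-B) B) := RealRMK.rieszMeasure Λp
  have hν₀ : ∀ φ : C(Icc (-B) B, ℝ), ∫ y, φ y ∂ν₀ = L φ := fun φ => by
    have h := RealRMK.integral_rieszMeasure Λp ⟨φ, HasCompactSupport.of_compactSpace φ⟩
    rw [hΛp] at h
    exact h
  haveI : IsProbabilityMeasure ν₀ := by
    constructor
    have h1 : ∫ y, (1 : C(Icc (-B) B, ℝ)) y ∂ν₀ = 1 := (hν₀ 1).trans hone
    simp only [ContinuousMap.one_apply, integral_const, smul_eq_mul, mul_one] at h1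
    rwa [measureReal_def, ENNReal.toReal_eq_one_iff] at h1
  -- push forward to `ℝ`
  have hpre : ((↑) : Icc (-B) B → ℝ) ⁻¹' (Icc (-B) B)ᶜ = ∅ := by
    ext y
    simp only [mem_preimage, mem_compl_iff, mem_empty_iff_false, iff_false, not_not]
    exact y.2
  refine ⟨ν₀.map ((↑) : Icc (-B) B → ℝ), Measure.isProbabilityMeasure_map measurable_subtype_coe.aemeasurable, ?_,
    fun f hf => ?_⟩
  · rw [Measure.map_apply measurable_subtype_coe measurableSet_Icc.compl, hpre, measure_empty]
  · rw [integral_map measurable_subtype_coe.aemeasurable hf.aestronglyMeasurable]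
    have h := hL ⟨fun y => f y, hf.comp continuous_subtype_val⟩
    rw [← hν₀] at h
    refine h.congr fun K => integral_congr_ae (Eventually.of_forall fun ω => ?_)
    simp only [ContinuousMap.coe_mk, projIcc_of_mem h0 (hmem K ω)]

/-- **WEAK CONVERGENCE OF THE LAWS** in Mathlib's words: if `∫ f(X K) dμ_K → ∫ f dν` for every continuous `f`, the laws `(μ K).map (X K)` converge
to `ν` in `ProbabilityMeasure ℝ` (the topology of convergence in distribution; `ProbabilityMeasure.tendsto_iff_forall_integral_tendsto`). [folklore] -/
theorem tendsto_law_of_lawLimit (hX : ∀ K, AEMeasurable (X K) (μ K)) (ν : ProbabilityMeasure ℝ)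
    (hν : ∀ f : ℝ → ℝ, Continuous f → Tendsto (fun K => ∫ ω, f (X K ω) ∂μ K) atTop (𝓝 (∫ x, f x ∂(ν : Measure ℝ)))) :
    Tendsto (β := ProbabilityMeasure ℝ) (fun K => ⟨(μ K).map (X K), Measure.isProbabilityMeasure_map (hX K)⟩) atTop (𝓝 ν) := by
  refine ProbabilityMeasure.tendsto_iff_forall_integral_tendsto.2 fun f => ?_
  exact (hν f f.continuous).congr fun K => (integral_map (hX K) f.continuous.aestronglyMeasurable).symm

omit [∀ K, IsProbabilityMeasure (μ K)] in
/-- **THE CONTINUUM LAW IS UNIQUE**: two probability measures receiving the limits `lim_K ∫ f(X K) dμ_K` of all continuous `f` coincide (bounded continuous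
functions separate finite Borel measures on `ℝ`, Mathlib `ext_of_forall_integral_eq_of_IsFiniteMeasure`). [folklore] -/
theorem lawLimit_unique (ν₁ ν₂ : Measure ℝ) [IsProbabilityMeasure ν₁] [IsProbabilityMeasure ν₂]
    (h₁ : ∀ f : ℝ → ℝ, Continuous f → Tendsto (fun K => ∫ ω, f (X K ω) ∂μ K) atTop (𝓝 (∫ x, f x ∂ν₁)))
    (h₂ : ∀ f : ℝ → ℝ, Continuous f → Tendsto (fun K => ∫ ω, f (X K ω) ∂μ K) atTop (𝓝 (∫ x, f x ∂ν₂))) : ν₁ = ν₂ :=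
  ext_of_forall_integral_eq_of_IsFiniteMeasure fun f => tendsto_nhds_unique (h₁ f f.continuous) (h₂ f f.continuous)

omit [∀ K, IsProbabilityMeasure (μ K)] in
/-- **THE MGFs CONVERGE TO THE MGF OF THE CONTINUUM LAW** at every real argument. [folklore] -/
theorem tendsto_mgf_of_lawLimit (ν : Measure ℝ)
    (hν : ∀ f : ℝ → ℝ, Continuous f → Tendsto (fun K => ∫ ω, f (X K ω) ∂μ K) atTop (𝓝 (∫ x, f x ∂ν))) (t : ℝ) :
    Tendsto (fun K => mgf (X K) (μ K) t) atTop (𝓝 (mgf id ν t)) :=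
  hν (fun x => Real.exp (t * x)) (by fun_prop)

/-- **THE CGFs CONVERGE TO THE CGF OF THE CONTINUUM LAW** at every real argument (its MGF is `≥ e^{−|t|B} > 0`). [folklore] -/
theorem tendsto_cgf_of_lawLimit (hX : ∀ K, AEMeasurable (X K) (μ K)) (hB : ∀ K ω, |X K ω| ≤ B) (ν : Measure ℝ)
    (hν : ∀ f : ℝ → ℝ, Continuous f → Tendsto (fun K => ∫ ω, f (X K ω) ∂μ K) atTop (𝓝 (∫ x, f x ∂ν))) (t : ℝ) :
    0 < mgf id ν t ∧ Tendsto (fun K => cgf (X K) (μ K) t) atTop (𝓝 (cgf id ν t)) := by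
  have hm := tendsto_mgf_of_lawLimit ν hν t
  have hpos : 0 < mgf id ν t := by
    refine (Real.exp_pos (-(|t| * B))).trans_le (ge_of_tendsto' hm fun K => ?_)
    have h := T4GenFunBounds.exp_neg_le_mgf_of_abs_le (hX K) (ae_of_all _ (hB K)) t
    rwa [probReal_univ, one_mul] at h
  exact ⟨hpos, ((Real.continuousAt_log hpos.ne').tendsto).comp hm⟩

/-- **THE COMPLEX MGFs CONVERGE TO THE FOURIER–LAPLACE TRANSFORM OF THE CONTINUUM LAW** at every `z ∈ ℂ` (real and imaginary parts are continuous
observables). [folklore] -/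
theorem tendsto_complexMGF_of_lawLimit (hX : ∀ K, AEMeasurable (X K) (μ K)) (hB : ∀ K ω, |X K ω| ≤ B) (ν : Measure ℝ) [IsProbabilityMeasure ν]
    (hνB : ν (Icc (-B) B)ᶜ = 0) (hν : ∀ f : ℝ → ℝ, Continuous f → Tendsto (fun K => ∫ ω, f (X K ω) ∂μ K) atTop (𝓝 (∫ x, f x ∂ν)))
    (z : ℂ) : Tendsto (fun K => complexMGF (X K) (μ K) z) atTop (𝓝 (complexMGF id ν z)) := by
  have hc : Continuous fun x : ℝ => Complex.exp (z * x) := by fun_prop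
  have hIK : ∀ K, Integrable (fun ω => Complex.exp (z * X K ω)) (μ K) := fun K =>
    integrable_comp_of_continuous (hX K) (ae_of_all _ (hB K)) hc
  have hνae : ∀ᵐ x ∂ν, |id x| ≤ B := by
    filter_upwards [measure_eq_zero_iff_ae_notMem.1 hνB] with x hx
    exact abs_le.2 (by simpa using hx)
  have hIν : Integrable (fun x : ℝ => Complex.exp (z * (id x : ℝ))) ν := integrable_comp_of_continuous aemeasurable_id hνae hc
  have hre : Tendsto (fun K => (complexMGF (X K) (μ K) z).re) atTop (𝓝 (complexMGF id ν z).re) := by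
    rw [re_complexMGF_eq_integral ν id z hIν]
    exact (hν (fun x => (Complex.exp (z * x)).re) (Complex.continuous_re.comp hc)).congr fun K =>
      (re_complexMGF_eq_integral (μ K) (X K) z (hIK K)).symm
  have him : Tendsto (fun K => (complexMGF (X K) (μ K) z).im) atTop (𝓝 (complexMGF id ν z).im) := by
    rw [im_complexMGF_eq_integral ν id z hIν]
    exact (hν (fun x => (Complex.exp (z * x)).im) (Complex.continuous_im.comp hc)).congr fun K =>
      (im_complexMGF_eq_integral (μ K) (X K) z (hIK K)).symm
  have h := ((Complex.continuous_ofReal.tendsto _).comp hre).add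
    (((Complex.continuous_ofReal.tendsto _).comp him).mul_const Complex.I)
  simp only [Function.comp_def, Complex.re_add_im] at h
  exact h

/-- **THE CHARACTERISTIC FUNCTIONS OF THE LAWS CONVERGE TO THAT OF THE CONTINUUM LAW** (the previous theorem on the imaginary axis; Mathlib
`complexMGF_mul_I`). [folklore] -/
theorem tendsto_charFun_of_lawLimit (hX : ∀ K, AEMeasurable (X K) (μ K)) (hB : ∀ K ω, |X K ω| ≤ B) (ν : Measure ℝ) [IsProbabilityMeasure ν]
    (hνB : ν (Icc (-B) B)ᶜ = 0) (hν : ∀ f : ℝ → ℝ, Continuous f → Tendsto (fun K => ∫ ω, f (X K ω) ∂μ K) atTop (𝓝 (∫ x, f x ∂ν)))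
    (t : ℝ) : Tendsto (fun K => charFun ((μ K).map (X K)) t) atTop (𝓝 (charFun ν t)) := by
  have h := tendsto_complexMGF_of_lawLimit hX hB ν hνB hν (t * Complex.I)
  rw [complexMGF_id_mul_I] at h
  exact h.congr fun K => complexMGF_mul_I (hX K) t

/-- **THE SOURCE-TILTED LAWS CONVERGE TO THE TILTED CONTINUUM LAW**: for every source `s` and every continuous `f`,
`∫ f(X K) d(μ_K tilted by s·X K) → ∫ f d(ν tilted by s·id)` (numerator and MGF denominator both converge, the denominator to `mgf id ν s > 0`). [folklore] -/
theorem tendsto_integral_comp_tilted_of_lawLimit (hX : ∀ K, AEMeasurable (X K) (μ K)) (hB : ∀ K ω, |X K ω| ≤ B) (ν : Measure ℝ)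
    (hν : ∀ f : ℝ → ℝ, Continuous f → Tendsto (fun K => ∫ ω, f (X K ω) ∂μ K) atTop (𝓝 (∫ x, f x ∂ν))) (s : ℝ) {f : ℝ → ℝ}
    (hf : Continuous f) :
    Tendsto (fun K => ∫ ω, f (X K ω) ∂(μ K).tilted (fun ω => s * X K ω)) atTop (𝓝 (∫ x, f x ∂ν.tilted (fun x => s * x))) := by
  have hpos := (tendsto_cgf_of_lawLimit hX hB ν hν s).1
  have hnum := hν (fun x => Real.exp (s * x) * f x) (by fun_prop)
  have hden := tendsto_mgf_of_lawLimit ν hν s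
  have h := (hden.inv₀ hpos.ne').mul hnum
  have e2 := integral_comp_tilted_eq ν id f s
  simp only [id] at e2
  rw [e2]
  simp only [mgf, id] at h
  refine h.congr fun K => ?_
  rw [integral_comp_tilted_eq]

/-- **THE CONTINUUM LAW IN NODE E3's WORDING**: if the cgf's `cgf (X K) (μ K)` converge on a real interval `(0, r)` then all moments converge (tree
`T4VitaliStep.tendsto_moment_of_tendsto_cgf`, Vitali) and the continuum law exists as above. [folklore] -/
theorem exists_lawLimit_of_tendsto_cgf (hX : ∀ K, AEMeasurable (X K) (μ K)) (hB : ∀ K ω, |X K ω| ≤ B) {r : ℝ} (hr : 0 < r)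
    (hconv : ∀ t : ℝ, 0 < t → t < r → ∃ y, Tendsto (fun K => cgf (X K) (μ K) t) atTop (𝓝 y)) :
    ∃ ν : Measure ℝ, IsProbabilityMeasure ν ∧ ν (Icc (-B) B)ᶜ = 0 ∧
      ∀ f : ℝ → ℝ, Continuous f → Tendsto (fun K => ∫ ω, f (X K ω) ∂μ K) atTop (𝓝 (∫ x, f x ∂ν)) :=
  exists_lawLimit_of_tendsto_moments hX hB (T4VitaliStep.tendsto_moment_of_tendsto_cgf hX hB hr hconv)

end Generic

end Summit.QuantumFields.YangMills.BalabanUVNodes.N19ContinuumLaw
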